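import Summits.SmoothPoincare4.SmoothPoincare4.Theses.SymplecticOrigami
import Summits.SmoothPoincare4.SmoothPoincare4.Theorems.SymplecticOrigamiFoldedSphereFoldExistenceTransport
import Summits.SmoothPoincare4.SmoothPoincare4.Theorems.SymplecticOrigamiFoldedSphereFoldExistenceSphere

/-!
# `FoldedSphereFoldExistence` holds for every manifold diffeomorphic to `S⁴`; `SPC4 ⇒` the item

Sanity / zero-slack bookkeeping for item `stmt-SmoothPoincare4-14076` (rung 0 of route
SymplecticOrigami): the conclusion of `FoldedSphereFoldExistence` — a folded symplectic form
(`Literature.Geometry.Symplectic.IsFoldedForm`) whose folding hypersurface is a chart 3-sphere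
`n ↦ e n` for a smooth embedding `e : ℝ⁴ → M` — holds for every `M` diffeomorphic to `S⁴`
(`exists_isFoldedForm_chartSphere_of_diffeomorph`: the round model
`exists_isFoldedForm_chartSphere_sphere`, `ω₀|_{S⁴}` folded along the inverse-stereographic chart
sphere, transported by `isFoldedForm_transport`), hence `SmoothPoincare4 → FoldedSphereFoldExistence`
(`foldedSphereFoldExistence_of_smoothPoincare4`). In particular the typed statement of the item is
satisfiable and correctly shaped at the standard sphere.
-/

noncomputable section

-- the prescribed namespace `Summit.<P>.<Sub>.…` duplicates `SmoothPoincare4` (P = Sub)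
set_option linter.dupNamespace false

open scoped Manifold ContDiff Topology ContinuousMap
open Set Function Metric
open Literature.Geometry.Symplectic Literature.Geometry.Kaehler

namespace Summit.SmoothPoincare4.SmoothPoincare4.Theorems.FoldedSphereFoldExistence

open Summit.SmoothPoincare4.SmoothPoincare4.Theses.SymplecticOrigami

/-- **Rung 0 for every `M` diffeomorphic to `S⁴`**: pull the round model
(`exists_isFoldedForm_chartSphere_sphere`: `ω₀|_{S⁴}` folded along the inverse stereographic
chart sphere) back along the diffeomorphism (`isFoldedForm_transport`). [folklore] -/
theorem exists_isFoldedForm_chartSphere_of_diffeomorph {M : Type*} [TopologicalSpace M]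
    [ChartedSpace (EuclideanSpace ℝ (Fin 4)) M] [IsManifold (𝓡 4) ∞ M]
    (Φ : M ≃ₘ⟮𝓡 4, 𝓡 4⟯ sphere (0 : EuclideanSpace ℝ (Fin 5)) 1) :
    ∃ (s : MForm (𝓡 4) M ℝ 2) (e : EuclideanSpace ℝ (Fin 4) → M),
      Manifold.IsSmoothEmbedding (𝓡 4) (𝓡 4) ∞ e ∧
        IsFoldedForm s (sphere (0 : EuclideanSpace ℝ (Fin 4)) 1) (fun n => e n) := by
  obtain ⟨s, e, he, hs⟩ := exists_isFoldedForm_chartSphere_sphere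
  exact ⟨s.pullback (𝓡 4) Φ, Φ.symm ∘ e, he.diffeomorph_comp Φ.symm, isFoldedForm_transport Φ hs⟩

/-- **`SmoothPoincare4 → FoldedSphereFoldExistence`** (sanity; the converse direction of the
rung): if every homotopy 4-sphere is diffeomorphic to `S⁴`, rung 0 holds by transport of the
round model. [folklore] -/
theorem foldedSphereFoldExistence_of_smoothPoincare4 (hS : _root_.SmoothPoincare4) :
    FoldedSphereFoldExistence := by
  intro M _ _ _ _ _ hM
  have hS' := hS
  unfold _root_.SmoothPoincare4 Literature.SPC4.SmoothPoincareConjectureFour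
    ContinuousMap.HomotopyEquiv.NonemptyDiffeomorphSphere at hS'
  obtain ⟨Φ⟩ := hS' M inferInstance inferInstance hM
  exact exists_isFoldedForm_chartSphere_of_diffeomorph Φ

end Summit.SmoothPoincare4.SmoothPoincare4.Theorems.FoldedSphereFoldExistence

end
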